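import Summits.BirchSwinnertonDyer.BirchSwinnertonDyer.Theorems.ByReductionTypeAtTwoMultUpperHalfTowerLocal
import Summits.BirchSwinnertonDyer.BirchSwinnertonDyer.Theorems.ByReductionTypeAtTwoMultTowerNS2OneBitDefs
import HarnessLib

/-!
# Route `ByReductionTypeAtTwo`, crux `MultUpperHalfAtTwo` (item stmt-BirchSwinnertonDyer-19922): the TOWER-gap certificate at a
# NON-SPLIT multiplicative `2` with ONE bit at the place over `2` (`C₂ = 2`), under the displayed MEMO binder `hNS2one`
# (`MultTowerNS2.localTowerKerTwoTorsion_le_two_nonsplitTwo_of_tateUnit`, cell memo HOME/mult2/gen7/PROOF-NS2ONE.md)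

HONEST FRAMING (cell `bsd-2adic`, run/shared/lean/pub/bsd-2adic/, seat `bsd-2adic-mult-2` GEN 7, HUMAN RULINGS D-0036 / D-0054 /
D-0074): research route; THEOREMS ONLY; nothing is booked; BSD is not proved by any of this. The two-bit door
`MultTowerCert.towerGapAtTwo_of_layerSelmer_cert_nonsplitTwo` (p446xxx, `…MultUpperHalfTowerLocal.lean`) reads its constant at `2` from the
PRINT fact `hNS2` (`#𝒦_{v,n}[2^∞] ≤ 4`, Greenberg p. 93): arithmetic `2^d · 4 · ∏ < 2^{2^{j′} − 2^{j} + a}`. This file is the SAME door with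
`C₂ = 2`, the bound `#𝒦_{v,j′}[2^∞][2] ≤ 2` being supplied by the MEMO binder `hNS2one` on the classes whose Tate unit is
`≡ ±3 (mod 8)` — displayed as `(∃ k u c, Δ_min = 2^k·u ∧ c₄ = c ∧ u·c % 8 ∈ {3,5})`, decided per class by `norm_num`. It moves 100
NON-SPLIT `E[2]`-irreducible classes of item 19922 from layer-≤3 margin `−1` to margin `0` (HOME mult2/gen7/NOTE-NS2-one-bit-question.md,
PROOF-NS2ONE.md §0). WHAT IS DISPLAYED, NOT PROVED: PRINT {`h33g`, `hM`, `hA`}; MEMO {`hNS2one`}; the layer counts `hlow`/`hup` and the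
arithmetic `harith`. References: R. Greenberg, LNM 1716 (1999) §3 pp. 85–93; cell memo PROOF-NS2ONE.md.
-/

set_option autoImplicit false
-- the Theorems namespace of this sub repeats the summit name by design (D-0017 nested layout: Summit.<S>.<Sub>)
set_option linter.dupNamespace false

noncomputable section

open scoped Classical MatrixGroups ModularForm

open NumberField IsDedekindDomain CongruenceSubgroup WeierstrassCurve Literature.NumberTheory.EllipticCurves
  Literature.NumberTheory.EllipticCurves.ModularForms
  Literature.NumberTheory.EllipticCurves.Greenberg1999
  Literature.NumberTheory.EllipticCurves.Rank1Residual
  Literature.NumberTheory.EllipticCurves.Rank1Residual.Typed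
  Literature.NumberTheory.GaloisRepresentations
  Summit.BirchSwinnertonDyer.Rank1Residual.X5 Summit.BirchSwinnertonDyer.Rank1Residual.X5.O1
  Summit.BirchSwinnertonDyer.Rank1Residual
  Summit.BirchSwinnertonDyer.BirchSwinnertonDyer.Theorems.KatoHalfPinch

namespace Summit.BirchSwinnertonDyer.BirchSwinnertonDyer.Theorems.MultTowerNS2

variable (W : WeierstrassCurve ℚ) [W.IsElliptic] [W.IsGloballyMinimal]

/-- **`h2` at a NON-SPLIT multiplicative `2` with ONE bit: `C₂ = 2`** at every upper layer `j′ ≥ 1`, from the MEMO binder `hNS2one`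
and the displayed Tate-unit datum `(Δ_min/2^k)·c₄ ≡ ±3 (mod 8)` (binder = cell memo PROOF-NS2ONE.md). [cite: GreenbergLNM1716, §3 pp. 86 and 93] -/
theorem atTwo_le_two_of_nonsplit_oneBit (hNS2one : localTowerKerTwoTorsion_le_two_nonsplitTwo_of_tateUnit)
    (hmult : W.HasMultiplicativeReductionAtPrime 2) (hns : ¬ W.HasSplitMultiplicativeReductionAtPrime 2)
    (hq : ∃ (k : ℕ) (u c : ℤ), W.minimalDiscriminantInt = 2 ^ k * u ∧ W.c₄ = (c : ℚ) ∧ (u * c % 8 = 3 ∨ u * c % 8 = 5))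
    {n : ℕ} (hn : 1 ≤ n) :
    ∀ κ : ZpExtension ℚ 2, κ.IsCyclotomic → ∀ v : HeightOneSpectrum (𝓞 ℚ), ((2 : ℕ) : 𝓞 ℚ) ∈ v.asIdeal →
      Finite {x : W.localTowerKerPrimary κ (v.adicCompletion ℚ) n // 2 • x = 0} ∧
        Nat.card {x : W.localTowerKerPrimary κ (v.adicCompletion ℚ) n // 2 • x = 0} ≤ 2 :=
  fun κ hκ v hv ↦ hNS2one W hmult hns hq κ hκ v hv n hn

/-- **The GAP certificate at a NON-SPLIT multiplicative `2` with ONE bit at `2`** (`E[2]` irreducible member: odd torsion order):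
PRINT {`h33g`, `hM`, `hA`} + MEMO {`hNS2one`} + the displayed Tate-unit datum + layer counts at `j ≤ j′`, `1 ≤ j′`, with the arithmetic
`2^d · 2 · ∏_{ℓ ∈ P} C_ℓ^{2^{min(j′, e_ℓ)}} < 2^{2^{j′} − 2^j + a}` ⟹ `O1.TowerGapAtTwo W`. (= `MultTowerCert.towerGapAtTwo_of_layerSelmer_cert_atTwo`
with `C₂ := 2`.) [cite: GreenbergLNM1716, §3 Lemmas 3.3–3.5 (PDF pp. 86–90) and pp. 90–93] [cite: SilvermanAEC2009, VII.1 Prop. 1.3, VII.5.1] -/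
theorem towerGapAtTwo_of_layerSelmer_cert_nonsplitTwo_oneBit
    (h33g : lemma33_localTowerKerPrimary_eq_bot_of_good.{0})
    (hM : lemma33_localTowerKerPrimary_cyclic_of_multiplicative.{0})
    (hA : lemma33_natCard_localTowerKerPrimary_le_four_of_additive.{0})
    (hNS2one : localTowerKerTwoTorsion_le_two_nonsplitTwo_of_tateUnit)
    (hmult : W.HasMultiplicativeReductionAtPrime 2) (hns : ¬ W.HasSplitMultiplicativeReductionAtPrime 2)
    (hq : ∃ (k : ℕ) (u c : ℤ), W.minimalDiscriminantInt = 2 ^ k * u ∧ W.c₄ = (c : ℚ) ∧ (u * c % 8 = 3 ∨ u * c % 8 = 5))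
    (htors : ¬ 2 ∣ W.torsionOrder) {j j' a d : ℕ} (hjj' : j ≤ j') (hj' : 1 ≤ j')
    (P : Finset ℕ) (hP : ∀ ℓ ∈ P, ℓ.Prime ∧ ℓ ≠ 2)
    (hΔ : ∀ ℓ : ℕ, ℓ.Prime → ℓ ≠ 2 → (ℓ : ℤ) ∣ W.minimalDiscriminantInt → ℓ ∈ P)
    (C e k : ℕ → ℕ) (he : ∀ ℓ ∈ P, ¬ 2 ^ (e ℓ + 4) ∣ ℓ ^ 2 - 1)
    (hC : ∀ (ℓ : ℕ) [Fact ℓ.Prime], ℓ ∈ P →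
      4 ≤ C ℓ ∨ (W.HasMultiplicativeReductionAtPrime ℓ ∧ 2 ≤ C ℓ) ∨
        (W.HasMultiplicativeReductionAtPrime ℓ ∧ (ℓ : ℤ) ^ k ℓ ∣ W.minimalDiscriminantInt ∧
          ¬ (ℓ : ℤ) ^ (k ℓ + 1) ∣ W.minimalDiscriminantInt ∧ ¬ 2 ∣ k ℓ ∧ 1 ≤ C ℓ) ∨
        (¬ (ℓ : ℤ) ∣ W.minimalDiscriminantInt ∧ 1 ≤ C ℓ))
    (hlow : ∀ κ : ZpExtension ℚ 2, κ.IsCyclotomic →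
      2 ^ a ≤ Nat.card {z : W.selmerLayer κ j // 2 • z = 0})
    (hup : ∀ κ : ZpExtension ℚ 2, κ.IsCyclotomic →
      Nat.card {z : W.selmerLayer κ j' // 2 • z = 0} ≤ 2 ^ d)
    (harith : 2 ^ d * 2 * ∏ ℓ ∈ P, C ℓ ^ 2 ^ min j' (e ℓ) < 2 ^ (2 ^ j' - 2 ^ j + a)) :
    TowerGapAtTwo W :=
  MultTowerCert.towerGapAtTwo_of_layerSelmer_cert_atTwo W h33g hM hA htors hjj' 2
    (atTwo_le_two_of_nonsplit_oneBit W hNS2one hmult hns hq hj') P hP hΔ C e k he hC hlow hup harith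

/-- The one-bit arithmetic: `d + m + 2 ≤ K + a` ⟹ `2^d · 2 · 2^m < 2^(K + a)`. [folklore] -/
theorem two_pow_mul_two_mul_two_pow_lt {d m K a : ℕ} (h : d + m + 2 ≤ K + a) :
    2 ^ d * 2 * 2 ^ m < 2 ^ (K + a) := by
  rw [show (2 : ℕ) ^ d * 2 * 2 ^ m = 2 ^ (d + 1 + m) by rw [pow_add, pow_add]; norm_num]
  exact Nat.pow_lt_pow_right (by norm_num) (by omega)

end Summit.BirchSwinnertonDyer.BirchSwinnertonDyer.Theorems.MultTowerNS2

end
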